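import Literature.Probability.Process.BrownianSkeletonLaw

/-!
# The law of the grid increments of the Brownian pair (helper for stub `stub_antiDampedGirsanov`, K3)

Helper file for line `lebesgue-flip-duality` of crux ★ `BondHeatUncertainty.LinearResponseFTUR`
(stmt-AtomisticToContinuum-9122). The damped / anti-damped splitting schemes of the chain on the
uniform grid `s_k = k h`, `k ≤ M`, `h = t/M`, are functions of the finite-dimensional Gaussian vector of
increments of the pair of Brownian paths over the grid,
`ξ(ω) = ((B¹_{s_{k+1}} - B¹_{s_k}, B²_{s_{k+1}} - B²_{s_k}))_{k<M} ∈ (Fin M → ℝ × ℝ)`.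
This file identifies its LAW with the product Lebesgue measure weighted by the product of centred
Gaussian densities of variance `h` (the reference measure of the discrete Cameron–Martin identity of
`…PredictableShift.lean`):

* `lintegral_prod_pi_fin` — Tonelli for a product of one-variable functions over `Measure.pi` on `Fin n`
  (`∫ ∏ f_i(x_i) = ∏ ∫ f_i`), and `pi_withDensity_fin` — a finite product of measures with densities is
  the product measure with the product density;
* `gridIncr`, `pairGridIncr` — the increments over the grid of one raw path / of the pair of Brownian
  paths; `map_gridIncr_eq_pi` — under the Wiener measure the grid increments of the canonical Brownian
  motion are independent `N(0, h)` (Mathlib `IsPreBrownianReal.hasIndepIncrements`, `hasLaw_sub`);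
* `gaussDensity2`, `piGaussDensity` — the densities; `map_pairGridIncr_wienerPair` — **the law of the
  pair's grid increments is `(vol on Fin M → ℝ × ℝ).withDensity (x ↦ ∏_k g_h(x_k))`**, `g_h` the
  product of two `N(0,h)` densities (registered sub-goal of the crux item), with the density everywhere
  positive and finite (`piGaussDensity_pos`, `piGaussDensity_ne_top`).
-/

noncomputable section

namespace Summit.AtomisticToContinuum.FouriersLaw.Theorems.LinearResponseFTUR

open MeasureTheory ProbabilityTheory Filter Set Function Finset
open scoped ENNReal NNReal
open Literature.Probability.Process

/-! ### Tonelli for products over `Measure.pi` on `Fin n`; finite products of densities -/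

/-- **Tonelli for a product of one-variable functions**: `∫ ∏_i f_i(x_i) d(⊗_i μ) = ∏_i ∫ f_i dμ` on
`Fin n → α` (induction on `n` through `piFinSuccAbove 0` and `lintegral_prod_mul`). -/
theorem lintegral_prod_pi_fin {α : Type*} [MeasurableSpace α] (μ : Measure α) [SigmaFinite μ] :
    ∀ (n : ℕ) (f : Fin n → α → ℝ≥0∞), (∀ i, Measurable (f i)) →
      ∫⁻ x, ∏ i, f i (x i) ∂(Measure.pi fun _ : Fin n => μ) = ∏ i, ∫⁻ a, f i a ∂μ := by
  intro n
  induction n with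
  | zero =>
    intro f _
    simp only [Finset.univ_eq_empty, Finset.prod_empty, lintegral_const, one_mul]
    rw [Measure.pi_univ]
    simp
  | succ n ih =>
    intro f hf
    have hmp := measurePreserving_piFinSuccAbove (fun _ : Fin (n + 1) => μ) 0
    set e := MeasurableEquiv.piFinSuccAbove (fun _ : Fin (n + 1) => α) 0 with he
    have hg : Measurable fun x : Fin (n + 1) → α => ∏ i, f i (x i) :=
      Finset.measurable_prod _ fun i _ => (hf i).comp (measurable_pi_apply i)
    rw [← hmp.symm.lintegral_comp_emb e.symm.measurableEmbedding]
    have hfun : ∀ p : α × (Fin n → α),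
        (∏ i, f i (e.symm p i)) = f 0 p.1 * ∏ j : Fin n, f (Fin.succ j) (p.2 j) := by
      intro p
      rw [Fin.prod_univ_succ]
      have h0 : e.symm p 0 = p.1 := by
        simp [he, MeasurableEquiv.piFinSuccAbove_symm_apply]
      have hs : ∀ j : Fin n, e.symm p (Fin.succ j) = p.2 j := by
        intro j
        have h1 : (Fin.succ j : Fin (n + 1)) = (0 : Fin (n + 1)).succAbove j := by simp
        rw [h1]
        simp [he, MeasurableEquiv.piFinSuccAbove_symm_apply]
      simp only [h0, hs]
    simp_rw [hfun]
    have hg' : Measurable fun x : Fin n → α => ∏ j, f (Fin.succ j) (x j) :=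
      Finset.measurable_prod _ fun j _ => (hf _).comp (measurable_pi_apply j)
    rw [lintegral_prod_mul (hf 0).aemeasurable hg'.aemeasurable,
      ih (fun j => f (Fin.succ j)) (fun j => hf _), Fin.prod_univ_succ]

/-- **A finite product of measures with densities is the product measure with the product density**
(`Fin n` factors, one base measure). -/
theorem pi_withDensity_fin {α : Type*} [MeasurableSpace α] (μ : Measure α) [SigmaFinite μ]
    {f : α → ℝ≥0∞} (hf : Measurable f) [SigmaFinite (μ.withDensity f)] (n : ℕ) :
    Measure.pi (fun _ : Fin n => μ.withDensity f) =
      (Measure.pi fun _ : Fin n => μ).withDensity fun x => ∏ i, f (x i) := by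
  refine Measure.pi_eq (μ := fun _ : Fin n => μ.withDensity f) fun s hs => ?_
  have hF : Measurable fun x : Fin n → α => ∏ i, f (x i) :=
    Finset.measurable_prod _ fun i _ => hf.comp (measurable_pi_apply i)
  rw [withDensity_apply _ (MeasurableSet.univ_pi hs), ← lintegral_indicator (MeasurableSet.univ_pi hs)]
  have hind : ∀ x : Fin n → α, (Set.pi univ s).indicator (fun x => ∏ i, f (x i)) x =
      ∏ i, (s i).indicator f (x i) := by
    intro x
    by_cases hx : x ∈ Set.pi univ s
    · rw [Set.indicator_of_mem hx]
      refine Finset.prod_congr rfl fun i _ => ?_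
      rw [Set.indicator_of_mem (hx i (Set.mem_univ i))]
    · rw [Set.indicator_of_notMem hx]
      simp only [Set.mem_pi, Set.mem_univ, true_implies, not_forall] at hx
      obtain ⟨i, hi⟩ := hx
      symm
      exact Finset.prod_eq_zero (Finset.mem_univ i) (Set.indicator_of_notMem hi _)
  simp_rw [hind]
  rw [lintegral_prod_pi_fin μ n (fun i => (s i).indicator f) fun i => hf.indicator (hs i)]
  refine Finset.prod_congr rfl fun i _ => ?_
  rw [withDensity_apply _ (hs i), lintegral_indicator (hs i)]

/-! ### Grid increments -/

/-- The increments of a raw path `w` over the uniform grid `s_k = k h`: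
`Δ_k w = w(s_{k+1}) - w(s_k)`, `k < M` (times read in `ℝ≥0` through `Real.toNNReal`). -/
def gridIncr (M : ℕ) (h : ℝ) (w : ℝ≥0 → ℝ) : Fin M → ℝ := fun k =>
  w (((k : ℝ) + 1) * h).toNNReal - w ((k : ℝ) * h).toNNReal

/-- The increments of the PAIR of Brownian paths `pairPath ω` over the grid, as a sequence in `ℝ × ℝ`. -/
def pairGridIncr (M : ℕ) (h : ℝ) (ω : WienerPair) : Fin M → ℝ × ℝ := fun k =>
  (gridIncr M h (pairPath ω).1 k, gridIncr M h (pairPath ω).2 k)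

/-- `gridIncr` of the continuous Brownian path is measurable in the raw path. -/
theorem measurable_gridIncr_brownian (M : ℕ) (h : ℝ) :
    Measurable fun (ω₁ : ℝ≥0 → ℝ) => gridIncr M h fun u => brownian u ω₁ := by
  refine measurable_pi_lambda _ fun k => ?_
  exact (measurable_brownian _).sub (measurable_brownian _)

/-- `pairGridIncr` is measurable. -/
theorem measurable_pairGridIncr (M : ℕ) (h : ℝ) : Measurable (pairGridIncr M h) := by
  refine measurable_pi_lambda _ fun k => ?_
  refine Measurable.prodMk ?_ ?_
  · exact ((measurable_pi_apply k).comp (measurable_gridIncr_brownian M h)).comp measurable_fst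
  · exact ((measurable_pi_apply k).comp (measurable_gridIncr_brownian M h)).comp measurable_snd

/-- The grid step in `ℝ≥0`: for `h ≥ 0`, `nndist s_{k+1} s_k = h`. -/
theorem nndist_grid_succ {h : ℝ} (hh : 0 ≤ h) (k : ℕ) :
    nndist (((((k : ℝ) + 1) * h).toNNReal : ℝ≥0) : ℝ) ((((k : ℝ) * h).toNNReal : ℝ≥0) : ℝ) =
      h.toNNReal := by
  have h1 : 0 ≤ (k : ℝ) * h := mul_nonneg k.cast_nonneg hh
  have h2 : 0 ≤ ((k : ℝ) + 1) * h := mul_nonneg (by positivity) hh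
  apply NNReal.coe_injective
  rw [coe_nndist, Real.dist_eq, Real.coe_toNNReal _ h2, Real.coe_toNNReal _ h1,
    Real.coe_toNNReal _ hh]
  rw [abs_of_nonneg (by nlinarith)]
  ring

/-- **The grid increments of the canonical Brownian motion are independent centred Gaussians of
variance `h`** (`h ≥ 0`). -/
theorem map_gridIncr_eq_pi (M : ℕ) {h : ℝ} (hh : 0 ≤ h) :
    preWienerMeasure.map (fun (ω₁ : ℝ≥0 → ℝ) => gridIncr M h fun u => brownian u ω₁) =
      Measure.pi fun _ : Fin M => gaussianReal 0 h.toNNReal := by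
  haveI := Literature.Probability.RandomPlanarGeometry.isProbabilityMeasure_preWienerMeasure'
  have hB := Literature.Probability.RandomPlanarGeometry.isPreBrownianReal_brownian
  have hmono : Monotone fun j : Fin (M + 1) => (((j : ℕ) : ℝ) * h).toNNReal := by
    intro i j hij
    apply Real.toNNReal_le_toNNReal
    exact mul_le_mul_of_nonneg_right (by exact_mod_cast hij) hh
  have hind : iIndepFun (fun (k : Fin M) (ω₁ : ℝ≥0 → ℝ) =>
      brownian ((((k : ℕ) : ℝ) + 1) * h).toNNReal ω₁ - brownian (((k : ℕ) : ℝ) * h).toNNReal ω₁)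
      preWienerMeasure := by
    have hI := hB.hasIndepIncrements M (fun j : Fin (M + 1) => (((j : ℕ) : ℝ) * h).toNNReal) hmono
    convert hI using 3
    simp
  have hmeas : ∀ k : Fin M, AEMeasurable (fun (ω₁ : ℝ≥0 → ℝ) =>
      brownian ((((k : ℕ) : ℝ) + 1) * h).toNNReal ω₁ - brownian (((k : ℕ) : ℝ) * h).toNNReal ω₁)
      preWienerMeasure :=
    fun k => ((measurable_brownian _).sub (measurable_brownian _)).aemeasurable
  have hpi := hind.map_fun_eq_pi_map hmeas
  change preWienerMeasure.map (fun (ω₁ : ℝ≥0 → ℝ) (k : Fin M) =>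
      brownian ((((k : ℕ) : ℝ) + 1) * h).toNNReal ω₁ - brownian (((k : ℕ) : ℝ) * h).toNNReal ω₁) = _
  rw [hpi]
  congr 1
  funext k
  have hlaw := (hB.hasLaw_sub ((((k : ℕ) : ℝ) + 1) * h).toNNReal (((k : ℕ) : ℝ) * h).toNNReal).map_eq
  convert hlaw using 2
  · rfl
  · exact (nndist_grid_succ hh k).symm

/-! ### The Gaussian densities and the law of the pair's increments -/

/-- The density of a pair of independent centred Gaussians of variance `h` on `ℝ × ℝ`. -/
def gaussDensity2 (h : ℝ) (v : ℝ × ℝ) : ℝ≥0∞ :=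
  gaussianPDF 0 h.toNNReal v.1 * gaussianPDF 0 h.toNNReal v.2

/-- The density of the pair's grid increments: `∏_k g_h(x_k)` on `Fin M → ℝ × ℝ`. -/
def piGaussDensity (M : ℕ) (h : ℝ) (x : Fin M → ℝ × ℝ) : ℝ≥0∞ := ∏ k, gaussDensity2 h (x k)

/-- `gaussDensity2` is measurable. -/
theorem measurable_gaussDensity2 (h : ℝ) : Measurable (gaussDensity2 h) :=
  ((measurable_gaussianPDF _ _).comp measurable_fst).mul
    ((measurable_gaussianPDF _ _).comp measurable_snd)

/-- `piGaussDensity` is measurable. -/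
theorem measurable_piGaussDensity (M : ℕ) (h : ℝ) : Measurable (piGaussDensity M h) :=
  Finset.measurable_prod _ fun k _ => (measurable_gaussDensity2 h).comp (measurable_pi_apply k)

/-- `piGaussDensity` is everywhere positive for `h > 0`. -/
theorem piGaussDensity_pos (M : ℕ) {h : ℝ} (hh : 0 < h) (x : Fin M → ℝ × ℝ) :
    piGaussDensity M h x ≠ 0 := by
  have hv : h.toNNReal ≠ 0 := by
    intro h0
    have := Real.toNNReal_eq_zero.1 h0
    linarith
  refine Finset.prod_ne_zero_iff.2 fun k _ => ?_
  exact mul_ne_zero (gaussianPDF_pos 0 hv _).ne' (gaussianPDF_pos 0 hv _).ne'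

/-- `piGaussDensity` is everywhere finite. -/
theorem piGaussDensity_ne_top (M : ℕ) (h : ℝ) (x : Fin M → ℝ × ℝ) : piGaussDensity M h x ≠ ∞ := by
  refine ENNReal.prod_ne_top fun k _ => ?_
  exact ENNReal.mul_ne_top gaussianPDF_ne_top gaussianPDF_ne_top

/-- For `h > 0`, the two-dimensional centred Gaussian `N(0,h) ⊗ N(0,h)` is Lebesgue measure on `ℝ × ℝ`
with density `gaussDensity2 h`. -/
theorem gaussianReal_prod_eq_withDensity {h : ℝ} (hh : 0 < h) :
    (gaussianReal 0 h.toNNReal).prod (gaussianReal 0 h.toNNReal) =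
      (volume : Measure (ℝ × ℝ)).withDensity (gaussDensity2 h) := by
  have hv : h.toNNReal ≠ 0 := by
    intro h0; have := Real.toNNReal_eq_zero.1 h0; linarith
  rw [gaussianReal_of_var_ne_zero 0 hv]
  show ((volume : Measure ℝ).withDensity _).prod ((volume : Measure ℝ).withDensity _) =
    ((volume : Measure ℝ).prod volume).withDensity _
  rw [prod_withDensity (measurable_gaussianPDF _ _) (measurable_gaussianPDF _ _)]
  rfl

/-- Lebesgue measure weighted by the two-dimensional Gaussian density is σ-finite. -/
instance sigmaFinite_volume_withDensity_gaussDensity2 (h : ℝ) :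
    SigmaFinite ((volume : Measure (ℝ × ℝ)).withDensity (gaussDensity2 h)) := by
  refine SigmaFinite.withDensity_of_ne_top (ae_of_all _ fun v => ?_)
  exact ENNReal.mul_ne_top gaussianPDF_ne_top gaussianPDF_ne_top

/-- **The law of the pair's grid increments** (registered sub-goal of the crux item): for `h > 0`, under
`wienerPair` the sequence of increments of the two Brownian paths over the grid `s_k = k h`, `k < M`, has
law `(vol on Fin M → ℝ × ℝ).withDensity (∏_k g_h(x_k))`, `g_h` the product of two `N(0,h)` densities —
i.e. the `2M` increments are independent `N(0, h)`. -/
theorem map_pairGridIncr_wienerPair :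
    ∀ (M : ℕ) (h : ℝ), 0 < h →
      wienerPair.map (pairGridIncr M h) =
        (volume : Measure (Fin M → ℝ × ℝ)).withDensity (piGaussDensity M h) := by
  intro M h hh
  haveI := Literature.Probability.RandomPlanarGeometry.isProbabilityMeasure_preWienerMeasure'
  -- the two components `(Δ B¹, Δ B²)` have law `(⊗ N) ⊗ (⊗ N)`
  set G : Measure (Fin M → ℝ) := Measure.pi fun _ : Fin M => gaussianReal 0 h.toNNReal with hG
  have h1 : wienerPair.map (fun ω : WienerPair =>
      (gridIncr M h (pairPath ω).1, gridIncr M h (pairPath ω).2)) = G.prod G := by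
    have hfun : (fun ω : WienerPair => (gridIncr M h (pairPath ω).1, gridIncr M h (pairPath ω).2)) =
        Prod.map (fun ω₁ : ℝ≥0 → ℝ => gridIncr M h fun u => brownian u ω₁)
          (fun ω₂ : ℝ≥0 → ℝ => gridIncr M h fun u => brownian u ω₂) := by
      funext ω; rfl
    rw [hfun, wienerPair, ← Measure.map_prod_map _ _ (measurable_gridIncr_brownian M h)
      (measurable_gridIncr_brownian M h), map_gridIncr_eq_pi M hh.le]
  -- transport along `(Fin M → ℝ × ℝ) ≃ᵐ (Fin M → ℝ) × (Fin M → ℝ)`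
  set e := MeasurableEquiv.arrowProdEquivProdArrow ℝ ℝ (Fin M) with he
  have he2 : MeasurePreserving e
      (Measure.pi fun _ : Fin M => (gaussianReal 0 h.toNNReal).prod (gaussianReal 0 h.toNNReal))
      (G.prod G) :=
    measurePreserving_arrowProdEquivProdArrow ℝ ℝ (Fin M) (fun _ => gaussianReal 0 h.toNNReal)
      fun _ => gaussianReal 0 h.toNNReal
  have hcomp : (fun ω : WienerPair => (gridIncr M h (pairPath ω).1, gridIncr M h (pairPath ω).2)) =
      e ∘ pairGridIncr M h := by
    funext ω; rfl
  have h2 : (wienerPair.map (pairGridIncr M h)).map e =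
      (Measure.pi fun _ : Fin M => (gaussianReal 0 h.toNNReal).prod (gaussianReal 0 h.toNNReal)).map e := by
    rw [Measure.map_map e.measurable (measurable_pairGridIncr M h), ← hcomp, h1, he2.map_eq]
  have h3 : wienerPair.map (pairGridIncr M h) =
      Measure.pi fun _ : Fin M => (gaussianReal 0 h.toNNReal).prod (gaussianReal 0 h.toNNReal) := by
    have h4 := congrArg (Measure.map e.symm) h2
    rwa [Measure.map_map e.symm.measurable e.measurable, Measure.map_map e.symm.measurable e.measurable,
      e.symm_comp_self, Measure.map_id, Measure.map_id] at h4
  rw [h3]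
  simp_rw [gaussianReal_prod_eq_withDensity hh]
  rw [pi_withDensity_fin (volume : Measure (ℝ × ℝ)) (measurable_gaussDensity2 h) M, volume_pi]
  rfl

end Summit.AtomisticToContinuum.FouriersLaw.Theorems.LinearResponseFTUR

end
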